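import Summits.KontsevichZagierPeriods.KontsevichZagierPeriods.Theorems.HurwitzMicroSectorsNormalFormPrincipleAngSigned
import Summits.KontsevichZagierPeriods.KontsevichZagierPeriods.Theorems.AbelContractionRealHyperellipticSectorPortAngAddK2
import Summits.KontsevichZagierPeriods.KontsevichZagierPeriods.Theorems.AbelContractionRealHyperellipticSectorPortAngCarriers

/-!
# Route AbelContraction — `RealHyperellipticSector` (crux stmt-KontsevichZagierPeriods-12475):
# the dimension-certified port, layer 4 — the signed arctangent element and its linearity

Helper file of the line `Lines/birth.lean` (stub `stub_bakerAlg`, `--supports` the crux): the port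
of `Theorems/HurwitzMicroSectorsNormalFormPrincipleAngSigned.lean` (namespace
`…NormalFormPrinciple.PiBox.Dlog`) INTO THE BUDGET `KZ.relationsLE 1`: the **signed arctangent
element** `E(θ, d)` of the quotient `FormalRep ⧸ relationsLE 1` (`E = [T(tan θ, d)]` for `θ ≥ 0`,
`−[T(tan(−θ), d)]` for `θ < 0`; `exists_signedAng`) is additive as long as all angles stay in
`(−π/2, π/2)` (`signedAng_add`, from the tangent addition law by moves in dimension `1`,
`Port.AngAddK2.ang_add_mem_relationsLE`), hence `ℤ`-linear on bounded integer combinations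
(`signedAng_nsmul`, `signedAng_zsmul`, `signedAng_sum` — registered sub-goal).

The closure properties of `θ ↦ (e^{iθ} algebraic)` (`isAlgebraic_exp_*`) and
`isAlgebraic_tan_of_exp` are reused from the originals; names and hypotheses are those of the
original with `relations ↦ relationsLE 1`.

Sources: M. Kontsevich, D. Zagier, *Periods* (2001), §1.2 rules (1), (2) [KontsevichZagier2001].
No definitions are introduced.
-/

noncomputable section

open MeasureTheory Set
open Literature.NumberTheory.Transcendental Literature.NumberTheory.Transcendental.KZ
open Literature.ModelTheory.ExponentialFields (IsSemialgebraic)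
open Complex

namespace Summit.KontsevichZagierPeriods.AbelContraction.RealHyperellipticSector.Port

namespace Dlog

open Summit.KontsevichZagierPeriods.HurwitzMicroSectors.NormalFormPrinciple.PiBox.Dlog
  (isAlgebraic_exp_neg_mul_I isAlgebraic_exp_add_mul_I isAlgebraic_exp_nat_mul_mul_I
    isAlgebraic_exp_int_mul_mul_I isAlgebraic_exp_sum_mul_I isAlgebraic_tan_of_exp)

/-! ## The signed arctangent element `E(θ, d)` of the quotient -/

/-- **The signed arctangent element.** For a family `RG` there is `E : ℝ → ℝ → FormalRep ⧸ relationsLE 1`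
with `E(θ, d) = [T(tan θ, d)]` for `θ ≥ 0` and `E(θ, d) = −[T(tan(−θ), d)]` for `θ < 0`.
(inside the budget `relationsLE 1`) [cite: KontsevichZagier2001, §1.2] -/
theorem exists_signedAng (RG : ℝ → ℝ → IntegralRep 1) :
    ∃ E : ℝ → ℝ → FormalRep ⧸ relationsLE 1,
      (∀ θ d, 0 ≤ θ → E θ d = QuotientAddGroup.mk' (relationsLE 1) (of (RG (Real.tan θ) d))) ∧
      ∀ θ d, θ < 0 → E θ d = -QuotientAddGroup.mk' (relationsLE 1) (of (RG (Real.tan (-θ)) d)) := by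
  classical
  exact ⟨fun θ d => if 0 ≤ θ then QuotientAddGroup.mk' (relationsLE 1) (of (RG (Real.tan θ) d))
      else -QuotientAddGroup.mk' (relationsLE 1) (of (RG (Real.tan (-θ)) d)),
    fun θ d h => if_pos h, fun θ d h => if_neg (not_le.mpr h)⟩

variable {RG : ℝ → ℝ → IntegralRep 1} {E : ℝ → ℝ → FormalRep ⧸ relationsLE 1}

/-- A carrier with non-positive tangent parameter has empty domain, hence is a relation.
(inside the budget `relationsLE 1`) [cite: KontsevichZagier2001, §1.2 rule (1)] -/
theorem ang_nonpos_mem_relationsLE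
    (hRG : ∀ t d, IsAlgebraic ℚ t → IsAlgebraic ℚ d →
      (RG t d).domain = {x | x 0 ∈ Set.Ioo 0 t} ∧ (RG t d).integrand = fun x => d / (1 + x 0 ^ 2))
    {t d : ℝ} (ht : IsAlgebraic ℚ t) (hd : IsAlgebraic ℚ d) (ht0 : t ≤ 0) : of (RG t d) ∈ relationsLE 1 :=
  slab_empty_mem_relationsLE _ (hRG t d ht hd).1 ht0

/-- `E(0, d) = 0`. (inside the budget `relationsLE 1`) [cite: KontsevichZagier2001, §1.2 rule (1)] -/
theorem signedAng_zero
    (hRG : ∀ t d, IsAlgebraic ℚ t → IsAlgebraic ℚ d →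
      (RG t d).domain = {x | x 0 ∈ Set.Ioo 0 t} ∧ (RG t d).integrand = fun x => d / (1 + x 0 ^ 2))
    (hEp : ∀ θ d, 0 ≤ θ → E θ d = QuotientAddGroup.mk' (relationsLE 1) (of (RG (Real.tan θ) d)))
    {d : ℝ} (hd : IsAlgebraic ℚ d) : E 0 d = 0 := by
  rw [hEp 0 d le_rfl, Real.tan_zero]
  exact (QuotientAddGroup.eq_zero_iff _).mpr (ang_nonpos_mem_relationsLE hRG isAlgebraic_zero hd le_rfl)

/-- `E(−θ, d) = −E(θ, d)`. (inside the budget `relationsLE 1`) [cite: KontsevichZagier2001, §1.2] -/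
theorem signedAng_neg
    (hRG : ∀ t d, IsAlgebraic ℚ t → IsAlgebraic ℚ d →
      (RG t d).domain = {x | x 0 ∈ Set.Ioo 0 t} ∧ (RG t d).integrand = fun x => d / (1 + x 0 ^ 2))
    (hEp : ∀ θ d, 0 ≤ θ → E θ d = QuotientAddGroup.mk' (relationsLE 1) (of (RG (Real.tan θ) d)))
    (hEn : ∀ θ d, θ < 0 → E θ d = -QuotientAddGroup.mk' (relationsLE 1) (of (RG (Real.tan (-θ)) d)))
    {θ d : ℝ} (hd : IsAlgebraic ℚ d) : E (-θ) d = -E θ d := by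
  rcases lt_trichotomy θ 0 with h | rfl | h
  · rw [hEp (-θ) d (by linarith), hEn θ d h, neg_neg]
  · rw [neg_zero, signedAng_zero hRG hEp hd, neg_zero]
  · rw [hEn (-θ) d (by linarith), hEp θ d h.le, neg_neg]

/-- **The addition law in angles, both non-negative**: for `0 ≤ θ₁, θ₂` with `θ₁ + θ₂ < Real.pi / 2` and
algebraic tangents, `[T(tan(θ₁+θ₂), d)] = [T(tan θ₁, d)] + [T(tan θ₂, d)]`.
(inside the budget `relationsLE 1`) [cite: KontsevichZagier2001, §1.2 rules (1), (2)] -/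
theorem signedAng_add_core
    (hRG : ∀ t d, IsAlgebraic ℚ t → IsAlgebraic ℚ d →
      (RG t d).domain = {x | x 0 ∈ Set.Ioo 0 t} ∧ (RG t d).integrand = fun x => d / (1 + x 0 ^ 2))
    {θ₁ θ₂ d : ℝ} (h₁ : 0 ≤ θ₁) (h₂ : 0 ≤ θ₂) (h₁₂ : θ₁ + θ₂ < Real.pi / 2)
    (ht₁ : IsAlgebraic ℚ (Real.tan θ₁)) (ht₂ : IsAlgebraic ℚ (Real.tan θ₂)) (hd : IsAlgebraic ℚ d) :
    QuotientAddGroup.mk' (relationsLE 1) (of (RG (Real.tan (θ₁ + θ₂)) d)) =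
      QuotientAddGroup.mk' (relationsLE 1) (of (RG (Real.tan θ₁) d)) +
        QuotientAddGroup.mk' (relationsLE 1) (of (RG (Real.tan θ₂) d)) := by
  have hπ := Real.pi_pos
  have hθ₁ : θ₁ < Real.pi / 2 := by linarith
  have hθ₂ : θ₂ < Real.pi / 2 := by linarith
  have hs0 : 0 ≤ Real.tan θ₁ := Real.tan_nonneg_of_nonneg_of_le_pi_div_two h₁ hθ₁.le
  have ht0 : 0 ≤ Real.tan θ₂ := Real.tan_nonneg_of_nonneg_of_le_pi_div_two h₂ hθ₂.le
  have hst : Real.tan θ₁ * Real.tan θ₂ < 1 := by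
    rcases h₁.eq_or_lt with h₁' | h₁'
    · rw [← h₁', Real.tan_zero, zero_mul]; exact one_pos
    · have hspos := Real.tan_pos_of_pos_of_lt_pi_div_two h₁' hθ₁
      have hlt : Real.tan θ₂ < (Real.tan θ₁)⁻¹ := by
        rw [← Real.tan_pi_div_two_sub]
        exact Real.tan_lt_tan_of_lt_of_lt_pi_div_two (by linarith) (by linarith) (by linarith)
      calc Real.tan θ₁ * Real.tan θ₂ < Real.tan θ₁ * (Real.tan θ₁)⁻¹ :=
            mul_lt_mul_of_pos_left hlt hspos
        _ = 1 := mul_inv_cancel₀ hspos.ne'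
  have hsum : θ₁ + θ₂ = Real.arctan ((Real.tan θ₁ + Real.tan θ₂) / (1 - Real.tan θ₁ * Real.tan θ₂)) := by
    rw [← Real.arctan_add hst, Real.arctan_tan (by linarith) hθ₁, Real.arctan_tan (by linarith) hθ₂]
  have h := AngAddK2.ang_add_mem_relationsLE hRG ht₁ ht₂ hd hs0 ht0 hst
  rw [hsum, Real.tan_arctan, add_comm (Real.tan θ₁)]
  rw [← QuotientAddGroup.eq_zero_iff] at h
  change QuotientAddGroup.mk' (relationsLE 1) _ = 0 at h
  rwa [map_sub, map_sub, sub_sub, sub_eq_zero] at h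

/-- The addition law for `E`, first angle non-negative. (inside the budget `relationsLE 1`) [cite: KontsevichZagier2001, §1.2 rules (1), (2)] -/
theorem signedAng_add_left
    (hRG : ∀ t d, IsAlgebraic ℚ t → IsAlgebraic ℚ d →
      (RG t d).domain = {x | x 0 ∈ Set.Ioo 0 t} ∧ (RG t d).integrand = fun x => d / (1 + x 0 ^ 2))
    (hEp : ∀ θ d, 0 ≤ θ → E θ d = QuotientAddGroup.mk' (relationsLE 1) (of (RG (Real.tan θ) d)))
    (hEn : ∀ θ d, θ < 0 → E θ d = -QuotientAddGroup.mk' (relationsLE 1) (of (RG (Real.tan (-θ)) d)))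
    {θ₁ θ₂ d : ℝ} (hs₁ : 0 ≤ θ₁) (h₁ : θ₁ < Real.pi / 2) (h₂ : |θ₂| < Real.pi / 2)
    (h₁₂ : |θ₁ + θ₂| < Real.pi / 2)
    (he₁ : IsAlgebraic ℚ (cexp ((θ₁:ℂ) * I))) (he₂ : IsAlgebraic ℚ (cexp ((θ₂:ℂ) * I)))
    (hd : IsAlgebraic ℚ d) : E (θ₁ + θ₂) d = E θ₁ d + E θ₂ d := by
  rw [abs_lt] at h₂ h₁₂
  have h12 := isAlgebraic_exp_add_mul_I he₁ he₂
  rcases le_or_gt 0 θ₂ with hs₂ | hs₂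
  · rw [hEp _ d (add_nonneg hs₁ hs₂), hEp _ d hs₁, hEp _ d hs₂]
    exact signedAng_add_core hRG hs₁ hs₂ h₁₂.2 (isAlgebraic_tan_of_exp he₁)
      (isAlgebraic_tan_of_exp he₂) hd
  rcases le_or_gt 0 (θ₁ + θ₂) with hs | hs
  · have hc := signedAng_add_core hRG (θ₁ := θ₁ + θ₂) (θ₂ := -θ₂) hs (by linarith) (by linarith)
      (isAlgebraic_tan_of_exp h12) (isAlgebraic_tan_of_exp (isAlgebraic_exp_neg_mul_I he₂)) hd
    rw [show θ₁ + θ₂ + -θ₂ = θ₁ by ring] at hc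
    rw [hEp _ d hs, hEp _ d hs₁, hEn _ d hs₂, hc]
    abel
  · have hc := signedAng_add_core hRG (θ₁ := -(θ₁ + θ₂)) (θ₂ := θ₁) (by linarith) hs₁ (by linarith)
      (isAlgebraic_tan_of_exp (isAlgebraic_exp_neg_mul_I h12)) (isAlgebraic_tan_of_exp he₁) hd
    rw [show -(θ₁ + θ₂) + θ₁ = -θ₂ by ring] at hc
    rw [hEn _ d hs, hEp _ d hs₁, hEn _ d hs₂, hc]
    abel

/-- **The addition law for the signed arctangent element**: `E(θ₁ + θ₂) = E(θ₁) + E(θ₂)` whenever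
`|θ₁|, |θ₂|, |θ₁ + θ₂| < Real.pi / 2` and `e^{iθ₁}`, `e^{iθ₂}` are algebraic.
(inside the budget `relationsLE 1`) [cite: KontsevichZagier2001, §1.2 rules (1), (2)] -/
theorem signedAng_add {RG : ℝ → ℝ → IntegralRep 1} {E : ℝ → ℝ → FormalRep ⧸ relationsLE 1}
    (hRG : ∀ t d, IsAlgebraic ℚ t → IsAlgebraic ℚ d →
      (RG t d).domain = {x | x 0 ∈ Set.Ioo 0 t} ∧ (RG t d).integrand = fun x => d / (1 + x 0 ^ 2))
    (hEp : ∀ θ d, 0 ≤ θ → E θ d = QuotientAddGroup.mk' (relationsLE 1) (of (RG (Real.tan θ) d)))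
    (hEn : ∀ θ d, θ < 0 → E θ d = -QuotientAddGroup.mk' (relationsLE 1) (of (RG (Real.tan (-θ)) d)))
    {θ₁ θ₂ d : ℝ} (h₁ : |θ₁| < Real.pi / 2) (h₂ : |θ₂| < Real.pi / 2) (h₁₂ : |θ₁ + θ₂| < Real.pi / 2)
    (he₁ : IsAlgebraic ℚ (cexp ((θ₁:ℂ) * I))) (he₂ : IsAlgebraic ℚ (cexp ((θ₂:ℂ) * I)))
    (hd : IsAlgebraic ℚ d) : E (θ₁ + θ₂) d = E θ₁ d + E θ₂ d := by
  rcases le_or_gt 0 θ₁ with hs₁ | hs₁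
  · exact signedAng_add_left hRG hEp hEn hs₁ (abs_lt.mp h₁).2 h₂ h₁₂ he₁ he₂ hd
  rcases le_or_gt 0 θ₂ with hs₂ | hs₂
  · rw [add_comm, signedAng_add_left hRG hEp hEn hs₂ (abs_lt.mp h₂).2 h₁ (by rwa [add_comm]) he₂ he₁ hd,
      add_comm]
  · rw [abs_lt] at h₁ h₂ h₁₂
    have hc := signedAng_add_core hRG (θ₁ := -θ₁) (θ₂ := -θ₂) (by linarith) (by linarith) (by linarith)
      (isAlgebraic_tan_of_exp (isAlgebraic_exp_neg_mul_I he₁))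
      (isAlgebraic_tan_of_exp (isAlgebraic_exp_neg_mul_I he₂)) hd
    rw [hEn _ d (by linarith : θ₁ + θ₂ < 0), hEn _ d hs₁, hEn _ d hs₂, neg_add, hc, neg_add]

/-- **Natural multiples**: `E(nθ) = n • E(θ)` if `n|θ| < Real.pi / 2`. (inside the budget `relationsLE 1`) [cite: KontsevichZagier2001, §1.2] -/
theorem signedAng_nsmul
    (hRG : ∀ t d, IsAlgebraic ℚ t → IsAlgebraic ℚ d →
      (RG t d).domain = {x | x 0 ∈ Set.Ioo 0 t} ∧ (RG t d).integrand = fun x => d / (1 + x 0 ^ 2))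
    (hEp : ∀ θ d, 0 ≤ θ → E θ d = QuotientAddGroup.mk' (relationsLE 1) (of (RG (Real.tan θ) d)))
    (hEn : ∀ θ d, θ < 0 → E θ d = -QuotientAddGroup.mk' (relationsLE 1) (of (RG (Real.tan (-θ)) d)))
    {θ d : ℝ} (he : IsAlgebraic ℚ (cexp ((θ:ℂ) * I))) (hd : IsAlgebraic ℚ d) :
    ∀ n : ℕ, (n : ℝ) * |θ| < Real.pi / 2 → E (n * θ) d = n • E θ d := by
  intro n
  induction n with
  | zero =>
    intro _
    rw [Nat.cast_zero, zero_mul, zero_smul]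
    exact signedAng_zero hRG hEp hd
  | succ n ih =>
    intro hn
    push_cast at hn ⊢
    have h0 := abs_nonneg θ
    have hθ : |θ| < Real.pi / 2 := by nlinarith
    have hn' : (n:ℝ) * |θ| < Real.pi / 2 := by nlinarith
    have hnθ : |(n:ℝ) * θ| < Real.pi / 2 := by rw [abs_mul, Nat.abs_cast]; exact hn'
    have hsum : |(n:ℝ) * θ + θ| < Real.pi / 2 := by
      rw [show (n:ℝ) * θ + θ = (n + 1) * θ by ring, abs_mul, abs_of_nonneg (by positivity)]
      exact hn
    rw [add_mul, one_mul, signedAng_add hRG hEp hEn hnθ hθ hsum (isAlgebraic_exp_nat_mul_mul_I he n)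
      he hd, ih hn', add_smul, one_smul]

/-- **Integer multiples**: `E(nθ) = n • E(θ)` if `|n||θ| < Real.pi / 2`. (inside the budget `relationsLE 1`) [cite: KontsevichZagier2001, §1.2] -/
theorem signedAng_zsmul
    (hRG : ∀ t d, IsAlgebraic ℚ t → IsAlgebraic ℚ d →
      (RG t d).domain = {x | x 0 ∈ Set.Ioo 0 t} ∧ (RG t d).integrand = fun x => d / (1 + x 0 ^ 2))
    (hEp : ∀ θ d, 0 ≤ θ → E θ d = QuotientAddGroup.mk' (relationsLE 1) (of (RG (Real.tan θ) d)))
    (hEn : ∀ θ d, θ < 0 → E θ d = -QuotientAddGroup.mk' (relationsLE 1) (of (RG (Real.tan (-θ)) d)))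
    {θ d : ℝ} (he : IsAlgebraic ℚ (cexp ((θ:ℂ) * I))) (hd : IsAlgebraic ℚ d) (n : ℤ)
    (hn : |(n : ℝ)| * |θ| < Real.pi / 2) : E (n * θ) d = n • E θ d := by
  obtain ⟨m, rfl | rfl⟩ := n.eq_nat_or_neg
  · rw [Int.cast_natCast, Nat.abs_cast] at hn
    rw [Int.cast_natCast, natCast_zsmul, signedAng_nsmul hRG hEp hEn he hd m hn]
  · rw [Int.cast_neg, Int.cast_natCast, abs_neg, Nat.abs_cast] at hn
    rw [Int.cast_neg, Int.cast_natCast, neg_mul, signedAng_neg hRG hEp hEn hd, neg_smul, natCast_zsmul,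
      signedAng_nsmul hRG hEp hEn he hd m hn]

/-- **Integer combinations** in `FormalRep ⧸ relationsLE 1` (registered sub-goal of crux
stmt-KontsevichZagierPeriods-12475, port of `PiBox.Dlog.signedAng_sum`): `E(Σ nᵢ gᵢ) = Σ nᵢ • E(gᵢ)`
if `Σ |nᵢ||gᵢ| < Real.pi / 2`, `|gᵢ| < Real.pi / 2` and all `e^{igᵢ}` are algebraic (all partial sums
stay inside `(−Real.pi / 2, Real.pi / 2)`).
(inside the budget `relationsLE 1`) [cite: KontsevichZagier2001, §1.2 rules (1), (2)] -/
theorem signedAng_sum : ∀ {RG : ℝ → ℝ → KZ.IntegralRep 1}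
    {E : ℝ → ℝ → KZ.FormalRep ⧸ KZ.relationsLE 1},
    (∀ t d, IsAlgebraic ℚ t → IsAlgebraic ℚ d →
      (RG t d).domain = {x | x 0 ∈ Set.Ioo 0 t} ∧ (RG t d).integrand = fun x => d / (1 + x 0 ^ 2)) →
    (∀ θ d, 0 ≤ θ → E θ d = QuotientAddGroup.mk' (KZ.relationsLE 1) (KZ.of (RG (Real.tan θ) d))) →
    (∀ θ d, θ < 0 →
      E θ d = -QuotientAddGroup.mk' (KZ.relationsLE 1) (KZ.of (RG (Real.tan (-θ)) d))) →
    ∀ {ι : Type*} (S : Finset ι) (g : ι → ℝ) (n : ι → ℤ) {d : ℝ}, IsAlgebraic ℚ d →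
    (∀ i ∈ S, IsAlgebraic ℚ (Complex.exp ((g i : ℂ) * Complex.I))) → (∀ i ∈ S, |g i| < Real.pi / 2) →
    ∑ i ∈ S, |(n i : ℝ)| * |g i| < Real.pi / 2 →
    E (∑ i ∈ S, (n i : ℝ) * g i) d = ∑ i ∈ S, n i • E (g i) d := by
  intro RG E hRG hEp hEn ι S g n d hd he hg hb
  classical
  induction S using Finset.induction_on with
  | empty =>
    rw [Finset.sum_empty, Finset.sum_empty]
    exact signedAng_zero hRG hEp hd
  | insert a S ha ih =>
    rw [Finset.sum_insert ha] at hb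
    rw [Finset.sum_insert ha, Finset.sum_insert ha]
    have hnn : ∀ i, 0 ≤ |(n i : ℝ)| * |g i| := fun i => by positivity
    have hSnn : 0 ≤ ∑ i ∈ S, |(n i : ℝ)| * |g i| := Finset.sum_nonneg fun i _ => hnn i
    have hbS : ∑ i ∈ S, |(n i : ℝ)| * |g i| < Real.pi / 2 := by linarith [hnn a]
    have hba : |(n a : ℝ) * g a| < Real.pi / 2 := by rw [abs_mul]; linarith
    have hS_abs' : |∑ i ∈ S, (n i : ℝ) * g i| ≤ ∑ i ∈ S, |(n i : ℝ)| * |g i| :=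
      (Finset.abs_sum_le_sum_abs _ _).trans (le_of_eq (Finset.sum_congr rfl fun i _ => abs_mul _ _))
    have hS_abs : |∑ i ∈ S, (n i : ℝ) * g i| < Real.pi / 2 := hS_abs'.trans_lt hbS
    have hsum_abs : |(n a : ℝ) * g a + ∑ i ∈ S, (n i : ℝ) * g i| < Real.pi / 2 := by
      refine (abs_add_le _ _).trans_lt ?_
      rw [abs_mul]
      linarith
    rw [signedAng_add hRG hEp hEn hba hS_abs hsum_abs
      (isAlgebraic_exp_int_mul_mul_I (he a (Finset.mem_insert_self a S)) (n a))
      (isAlgebraic_exp_sum_mul_I S (fun i => (n i : ℝ) * g i) fun i hi =>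
        isAlgebraic_exp_int_mul_mul_I (he i (Finset.mem_insert_of_mem hi)) (n i)) hd,
      ih (fun i hi => he i (Finset.mem_insert_of_mem hi)) (fun i hi => hg i (Finset.mem_insert_of_mem hi))
        hbS,
      signedAng_zsmul hRG hEp hEn (he a (Finset.mem_insert_self a S)) hd (n a) ?_]
    have hga := hg a (Finset.mem_insert_self a S)
    -- `|n a| |g a| < Real.pi / 2`
    linarith [hnn a]

end Dlog


end Summit.KontsevichZagierPeriods.AbelContraction.RealHyperellipticSector.Port

end
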